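import Summits.ResolutionOfSingularities.ResolutionOfSingularities.Theorems.EquisingularLiftEquisingularLiftOrdinaryPointsNonsingularLinSubst
import Summits.ResolutionOfSingularities.ResolutionOfSingularities.Theorems.EquisingularLiftEquisingularLiftOrdinaryPointsChartExpansion
import HarnessLib

/-!
# [OURS · tools] LINEAR FORMS, THEIR CHARTS AT A VERTEX, AND THE LINEAR PART OF A VERTEX-FIXING SUBSTITUTION
# (toward the intrinsic «ordinary multiple points in general position» theorem of cruxes `EquisingularLiftNat(Three)` / `EquisingularLift`)

[OURS · leafhand-res-equisingularlift-7 g1, 2026-08-31; cell `pub/decomp-res`] AI-produced, weaker than expert review; NOT a statement of any manuscript.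
DEF-FREE helper; no `sorry`; standard axioms.

* `MultiOrd.exists_eq_sum_smul_X` — a form of degree `1` is `Σ_l a_l x_l` (Mathlib `homogeneousSubmodule_one_eq_span_X`);
* `MultiOrd.aeval_insertNth_eq_of_eval_single_eq_zero` — for a linear form `q` with `q(e_c) = 0`, `q(T, M)` does not depend on the value `T` put at `x_c`;
* `MultiOrd.eval_smul_of_isHomogeneous_one` — `q(s·x) = s·q(x)`;
* `MultiOrd.isHomogeneous_one_dehomogenize` — the chart `q(x_c := 1)` of a linear form vanishing at `e_c` is again a linear form (the LINEAR PART);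
* `MultiOrd.aeval_dehomogenize_eq` — `M*(q(x_c:=1)) = q(1, M)` (`aeval M ∘ dehomogenize c = aeval (insertNth c 1 M)`);
* ★ `MultiOrd.aeval_linearPart_linearPart` — for mutually inverse linear substitutions `σ, σ'` both fixing the vertex `[e_c]`, the linear parts
  `M_j = σ_{c.succAbove j}(x_c := 1)`, `M'_j = σ'_{c.succAbove j}(x_c := 1)` are mutually inverse linear substitutions of the chart: `M*(M'_j) = y_j`.

References: [Hartshorne1977, I §2, II Example 7.1.1].
-/

set_option linter.dupNamespace false -- mandated namespace `Summit.<Summit>.<Problem>` of this single-conjunct summit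

noncomputable section

open MvPolynomial
open Literature.AlgebraicGeometry.Motives Literature.AlgebraicGeometry.Motives.ProjectiveSpace

namespace Summit.ResolutionOfSingularities.ResolutionOfSingularities.Cruxes.EquisingularLiftNat.Sections

namespace MultiOrd

variable {K : Type} [Field K] {N : ℕ}

/-- A form of degree `1` is a linear combination of the variables. [folklore] -/
theorem exists_eq_sum_smul_X {q : MvPolynomial (Fin (N + 1)) K} (hq : q.IsHomogeneous 1) :
    ∃ a : Fin (N + 1) → K, q = ∑ l, a l • (X l : MvPolynomial (Fin (N + 1)) K) := by
  have hmem : q ∈ Submodule.span K (Set.range (X : Fin (N + 1) → MvPolynomial (Fin (N + 1)) K)) := by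
    rw [← MvPolynomial.homogeneousSubmodule_one_eq_span_X]
    exact (mem_homogeneousSubmodule 1 q).mpr hq
  obtain ⟨a, ha⟩ := Submodule.mem_span_range_iff_exists_fun K |>.mp hmem
  exact ⟨a, ha.symm⟩

/-- `g*(Σ a_l x_l) = Σ a_l g_l`. [folklore] -/
theorem aeval_sum_smul_X {S : Type} [CommRing S] [Algebra K S] (a : Fin (N + 1) → K) (g : Fin (N + 1) → S) :
    aeval g (∑ l, a l • (X l : MvPolynomial (Fin (N + 1)) K)) = ∑ l, a l • g l := by
  rw [map_sum]
  exact Finset.sum_congr rfl fun l _ => by rw [map_smul, aeval_X]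

/-- The value of `Σ a_l x_l` at the vertex `e_c` is `a_c`. [folklore] -/
theorem eval_single_sum_smul_X (a : Fin (N + 1) → K) (c : Fin (N + 1)) :
    eval (Pi.single c 1 : Fin (N + 1) → K) (∑ l, a l • (X l : MvPolynomial (Fin (N + 1)) K)) = a c := by
  rw [show eval (Pi.single c 1 : Fin (N + 1) → K) (∑ l, a l • (X l : MvPolynomial (Fin (N + 1)) K)) =
      aeval (Pi.single c 1 : Fin (N + 1) → K) (∑ l, a l • (X l : MvPolynomial (Fin (N + 1)) K)) from rfl, aeval_sum_smul_X]
  simp only [smul_eq_mul, Pi.single_apply, mul_ite, mul_one, mul_zero, Finset.sum_ite_eq', Finset.mem_univ, if_true]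

/-- **For a linear form `q` with `q(e_c) = 0`, `q(…, T at x_c, …)` does not depend on `T`.** [folklore] -/
theorem aeval_insertNth_eq_of_eval_single_eq_zero {S : Type} [CommRing S] [Algebra K S] (c : Fin (N + 1))
    {q : MvPolynomial (Fin (N + 1)) K} (hq : q.IsHomogeneous 1) (h0 : eval (Pi.single c 1 : Fin (N + 1) → K) q = 0)
    (T T' : S) (M : Fin N → S) :
    aeval (Fin.insertNth c T M) q = aeval (Fin.insertNth c T' M) q := by
  obtain ⟨a, rfl⟩ := exists_eq_sum_smul_X hq
  rw [eval_single_sum_smul_X] at h0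
  rw [aeval_sum_smul_X, aeval_sum_smul_X, Fin.sum_univ_succAbove _ c, Fin.sum_univ_succAbove _ c, h0, zero_smul, zero_smul]
  simp only [Fin.insertNth_apply_succAbove, zero_add]

/-- `q(s·x) = s·q(x)` for a linear form `q`. [folklore] -/
theorem eval_smul_of_isHomogeneous_one {q : MvPolynomial (Fin (N + 1)) K} (hq : q.IsHomogeneous 1) (s : K) (x : Fin (N + 1) → K) :
    eval (s • x) q = s * eval x q := by
  obtain ⟨a, rfl⟩ := exists_eq_sum_smul_X hq
  rw [show eval (s • x) (∑ l, a l • (X l : MvPolynomial (Fin (N + 1)) K)) = aeval (s • x) (∑ l, a l • (X l : MvPolynomial (Fin (N + 1)) K))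
      from rfl, show eval x (∑ l, a l • (X l : MvPolynomial (Fin (N + 1)) K)) = aeval x (∑ l, a l • (X l : MvPolynomial (Fin (N + 1)) K))
      from rfl, aeval_sum_smul_X, aeval_sum_smul_X, Finset.mul_sum]
  exact Finset.sum_congr rfl fun l _ => by simp only [smul_eq_mul, Pi.smul_apply]; ring

/-- **The linear part**: the chart `q(x_c := 1)` of a linear form `q` with `q(e_c) = 0` is a form of degree `1` in the chart variables. [folklore] -/
theorem isHomogeneous_one_dehomogenize (c : Fin (N + 1)) {q : MvPolynomial (Fin (N + 1)) K} (hq : q.IsHomogeneous 1)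
    (h0 : eval (Pi.single c 1 : Fin (N + 1) → K) q = 0) :
    (ProjectiveSpace.dehomogenize K c q).IsHomogeneous 1 := by
  obtain ⟨a, rfl⟩ := exists_eq_sum_smul_X hq
  rw [eval_single_sum_smul_X] at h0
  rw [ProjectiveSpace.dehomogenize, aeval_sum_smul_X, Fin.sum_univ_succAbove _ c, h0, zero_smul, zero_add]
  refine IsHomogeneous.sum _ _ _ fun j _ => ?_
  rw [Fin.insertNth_apply_succAbove, smul_eq_C_mul]
  have h := (isHomogeneous_C (Fin N) (a (c.succAbove j))).mul (isHomogeneous_X K j)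
  rwa [zero_add] at h

/-- `M*(q(x_c := 1)) = q(1, M₀, …)`: substituting into a chart is substituting `x_c ↦ 1`, `x_{c.succAbove i} ↦ M_i`. [folklore] -/
theorem aeval_dehomogenize_eq {S : Type} [CommRing S] [Algebra K S] (c : Fin (N + 1)) (M : Fin N → S) (q : MvPolynomial (Fin (N + 1)) K) :
    aeval M (ProjectiveSpace.dehomogenize K c q) = aeval (Fin.insertNth c 1 M) q := by
  rw [ProjectiveSpace.dehomogenize, ← AlgHom.comp_apply, MvPolynomial.comp_aeval]
  congr 2
  funext l
  rcases Fin.eq_self_or_eq_succAbove c l with rfl | ⟨j, rfl⟩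
  · simp [Fin.insertNth_apply_same]
  · simp [Fin.insertNth_apply_succAbove]

/-- The chart tuple `(σ_l(x_c := 1))_l` is `insertNth c (σ_c(x_c:=1)) M` with `M_i = σ_{c.succAbove i}(x_c := 1)`. [folklore] -/
theorem dehomogenize_comp_eq_insertNth (c : Fin (N + 1)) (σ : Fin (N + 1) → MvPolynomial (Fin (N + 1)) K) :
    (fun l => ProjectiveSpace.dehomogenize K c (σ l)) =
      Fin.insertNth c (ProjectiveSpace.dehomogenize K c (σ c)) (fun i => ProjectiveSpace.dehomogenize K c (σ (c.succAbove i))) := by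
  funext l
  rcases Fin.eq_self_or_eq_succAbove c l with rfl | ⟨j, rfl⟩
  · rw [Fin.insertNth_apply_same]
  · rw [Fin.insertNth_apply_succAbove]

/-- ★ **The linear parts of mutually inverse vertex-fixing linear substitutions are mutually inverse.**  `σ, σ'` substitutions with
`σ*(σ'_i) = x_i`, `σ'` consisting of linear forms vanishing at `e_c` for `i ≠ c` (it fixes the vertex `[e_c]`); `M_i = σ_{c.succAbove i}(x_c := 1)`,
`M'_j = σ'_{c.succAbove j}(x_c := 1)`.  Then `M*(M'_j) = y_j`. [cite: Hartshorne1977, II Example 7.1.1] -/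
theorem aeval_linearPart_linearPart (c : Fin (N + 1)) (σ σ' : Fin (N + 1) → MvPolynomial (Fin (N + 1)) K)
    (hσ' : ∀ i, (σ' i).IsHomogeneous 1) (hinv : ∀ i, aeval σ (σ' i) = X i)
    (hfix : ∀ i, i ≠ c → eval (Pi.single c 1 : Fin (N + 1) → K) (σ' i) = 0) (j : Fin N) :
    aeval (fun i => ProjectiveSpace.dehomogenize K c (σ (c.succAbove i))) (ProjectiveSpace.dehomogenize K c (σ' (c.succAbove j))) = X j := by
  have h1 : ProjectiveSpace.dehomogenize K c (aeval σ (σ' (c.succAbove j))) = X j := by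
    rw [hinv, ProjectiveSpace.dehomogenize_X_succAbove]
  rw [dehomogenize_aeval, dehomogenize_comp_eq_insertNth] at h1
  rw [aeval_dehomogenize_eq, aeval_insertNth_eq_of_eval_single_eq_zero c (hσ' _) (hfix _ (Fin.succAbove_ne c j)) 1
    (ProjectiveSpace.dehomogenize K c (σ c))]
  exact h1

end MultiOrd

end Summit.ResolutionOfSingularities.ResolutionOfSingularities.Cruxes.EquisingularLiftNat.Sections

end
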